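import Summits.ABC.IUTFork.Cor312LicenceWildExactRealising
import Literature.IUT.LogVolume.TensorPacketLicenceCellConjugate
import Literature.IUT.LogVolume.TensorPacketFactorDifferentBound
import Literature.IUT.LogVolume.LogShellTopology
import HarnessLib

/-!
# [IUTchIII] Cor. 3.12 — the (xi-f) licence / branch C's antecedent INHABITED for realising ideles from PER-PLACE INTEGERS:
# the all-packets, all-tuples composition of the exact wild cell (R-W lane U, W1 «ROW DECISIONS», inhabited side)

PROOF-ONLY file (D-0012; 0 definitions, 0 `Prop` facts) of the abc-iut cell — D-0079 RESCUE sub-cell R-W «WINDOW Θ-SIDE INEQUALITY»,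
W1 ROW DECISIONS composer seat abc-iut-W-row-1 (gen 0), over abc-iut-w4-d036's U2-LICENCE-WRAPPER
(`Cor312LicenceWildExactCellIff` p460046 / `Cor312LicenceWildExactRealising` p460573). TAKES NO SIDE on [IUTchIII] Cor. 3.12
(S. Mochizuki, *Inter-universal Teichmüller theory III*, Cor. 3.12 p. 173 l. 41 – p. 174 l. 19; Step (xi-f) p. 184 l. 26–29) or on
any author: statements about OUR typed objects (abc-iut-c312-7's `settingPrVolSharp`, abc-iut-c312-5's `presAt` and typed (Ind1)(Ind2),
abc-iut-c312-1's `Thm311ToCor312.Licence`, branch C's `QPinned ∧ PilotKummerCompatHull`); the hull-level licence is a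
STRONGER-THAN-PRINT reading of Step (xi-f); nothing here bears on the printed GLOBAL inequality or the number-level corollary; the
existence of initial Θ-data realising the hypotheses is NOT claimed. typed ≠ proved; instantiated ≠ endorsed.

WHY. The wrapper p460573 decides `Licence` for ANY choice of abc-iut-c312-5's inner/outer shell-radius binders at EVERY fibre point of EVERY
prime; to DECIDE a WINDOW-TABLE row on the INHABITED side one needs (a) that such binders EXIST everywhere and (b) the composition «per-place
integers at the BAD places ⇒ the predicate for EVERY tuple» (mixed and good tuples, the (Ind1) slot permutation, the least factor different).

WHAT IS PROVED (namespace `Summit.ABC.IUTFork.Thm311.Real`).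
* §1 `exists_shellRadii_binders` — for EVERY proper ultrametric normed `ℚ_p`-algebra field `K`: elements `cin, cout ∈ K` with
  `cin ≠ 0`, `cin·𝒪_K ⊆ log_p(𝒪_K^×)`, maximality (`∃ ϖ w, w ∉ log_p(𝒪^×), ‖w‖·‖ϖ‖ ≤ ‖cin‖`), `cout ∈ log_p(𝒪^×) \ {0}` of largest norm
  (compact-open `log_p(𝒪_K^×)`, `LogShellTopology`; the least `n ∈ ℤ` with `ϖⁿ𝒪 ⊆ log_p(𝒪^×)`).
* §2 **`licence_settingPrVolSharp_of_orders_of_realises`** — Θ- and q-ideles REALISING the pilot divisors of `X` (Dupuy–Hilado (3.4)).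
  At every prime `p` below a bad place: every BAD fibre point `x | p` has `e(K_x/ℚ_p) = e_p`, `d(K_x) ≥ D_p/e_p`, `P_q(x) = P_p`, a NON-member
  `z ∉ log_p(𝒪^×_{K_x})` with `‖z‖ ≤ p^{−(ρin_p − 1)/e_p}` (so every inner radius has `‖cin‖ ≤ p^{−ρin_p/e_p}`) and a MEMBER `z'` with
  `‖z'‖ ≥ p^{−ρout_p/e_p}`; the bad completions over `p` are pairwise `ℚ_p`-isomorphic (`d_I − min_J d_{L_J} = (|I|−1)·d(K_x)`, abc-iut-w6-d018 /
  abc-iut-w5-d180); and at every label `j = i+1 ≤ l⋆` **`e_p·⌊(j²P_p − j·D_p − (j+1)·ρin_p)/e_p⌋ + (j+1)·ρout_p ≤ P_p`**. THEN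
  `Thm311ToCor312.Licence (settingPrVolSharp X …)`. Tuples with a GOOD slot are unconditional (`d_{L_J} ≤ d_I`, `‖cin‖ ≤ ‖cout‖`, `‖t_q‖ ≤ 1`).
* **`exists_qPinned_and_hull_settingPrVolSharp_of_orders_of_realises`** — the same conclusion for branch C's per-datum antecedent
  «∃ ρ qK, QPinned ∧ PilotKummerCompatHull» (any columns), via abc-iut-w5-d009's `exists_qPinned_and_hull_settingPrVolSharp_iff_licence`.
READING (neutral): the INHABITED side of a WINDOW-TABLE row (HOME/plan/rescue/R-W) needs only ONE-SIDED local inputs at the bad places —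
a lower bound on the different, any NON-member of `log_p(𝒪^×)` (inner radius from above), any MEMBER (outer radius from below) — plus
conjugacy of the bad fibre; the exact radii of abc-iut-c312-3 / abc-iut-s2-p12 are not required. HONEST SCOPE as in the wrapper; no side taken.
[cite: Mochizuki2012, IUTchIII Cor. 3.12 p. 173–175, Step (xi) (xi-d)(xi-f) p. 183–184, Thm. 3.11 (i) p. 154; IUTchIV Prop. 1.1 p. 9,
Prop. 1.2 (i)(ii) p. 10] [cite: DupuyHilado2025, §3.3, §3.4, §3.9, §4.9, §4.12] [cite: NeukirchANT1999, Ch. II (5.5)]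
[claim: Mochizuki2012, status: disputed] for every IUT sentence quoted.
-/

noncomputable section

open Set Function Metric
open scoped Pointwise TensorProduct

namespace Summit.ABC.IUTFork.Thm311.Real

open Cor312 Cor312.Setting Cor312Vol Cor312Vol.ExplicitDepth Literature.IUT.LogThetaLattice Literature.IUT.LogVolume NumberField
  IsDedekindDomain
open Literature.NumberTheory.NumberFields Literature.NumberTheory.GaloisRepresentations.Ultrametric

/-! ## §1. abc-iut-c312-5's inner/outer shell-radius binders EXIST in every local field -/

section Binders

variable (p : ℕ) [Fact p.Prime] (K : Type) [NontriviallyNormedField K] [instK : NormedAlgebra ℚ_[p] K] [IsUltrametricDist K]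
  [ProperSpace K]

include instK in
/-- **The inner/outer shell radii exist.** For every proper ultrametric normed `ℚ_p`-algebra field `K` there are `cin, cout ∈ K` with:
`cin ≠ 0`; `cin·o ∈ log_p(𝒪_K^×)` for all `‖o‖ ≤ 1`; maximality — a norm uniformizer `ϖ` and some `w ∉ log_p(𝒪_K^×)` with
`‖w‖·‖ϖ‖ ≤ ‖cin‖`; `cout ≠ 0`, `cout ∈ log_p(𝒪_K^×)`, and `‖z‖ ≤ ‖cout‖` for every `z ∈ log_p(𝒪_K^×)` (abc-iut-c312-5's binder convention
`hin0/hin/hmax/hout0/houtΛ/hdom`). Proof: `log_p(𝒪_K^×)` is compact, open and contains `0` (`LogShellTopology`); take `cin = ϖ^{n₀}` for the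
LEAST integer `n₀` with `ϖ^{n₀}𝒪 ⊆ log_p(𝒪^×)` and `cout` a point of largest norm. [cite: NeukirchANT1999, Ch. II (5.5)]
[cite: Mochizuki2012, IUTchIV Prop. 1.2 (i)(ii) p. 10] -/
theorem exists_shellRadii_binders :
    ∃ cin cout : K, cin ≠ 0 ∧ (∀ o : K, ‖o‖ ≤ 1 → cin * o ∈ logUnits K) ∧
      (∃ (ϖ : Kˣ) (w : K), IsUniformizer ϖ ∧ w ∉ logUnits K ∧ ‖w‖ * ‖(ϖ : K)‖ ≤ ‖cin‖) ∧
      cout ≠ 0 ∧ cout ∈ logUnits K ∧ ∀ z ∈ logUnits K, ‖z‖ ≤ ‖cout‖ := by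
  obtain ⟨ϖ, hϖ⟩ := exists_isUniformizer (F := K)
  have hϖ0 : 0 < ‖(ϖ : K)‖ := norm_units_pos ϖ
  have hϖ1 : ‖(ϖ : K)‖ < 1 := hϖ.1
  have hcpt : IsCompact (logUnits K) := isCompact_logUnits p K
  obtain ⟨R, hR⟩ := hcpt.isBounded.subset_closedBall (0 : K)
  have hp0 : (0 : ℝ) < (p : ℝ) ^ (-(2 : ℝ)) := Real.rpow_pos_of_pos (by exact_mod_cast (Fact.out : p.Prime).pos) _
  obtain ⟨N, hN⟩ := exists_pow_lt_of_lt_one hp0 hϖ1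
  have hPN : closedBall (0 : K) (‖(ϖ : K)‖ ^ (N : ℤ)) ⊆ logUnits K := by
    intro z hz
    rw [mem_closedBall, dist_zero_right, zpow_natCast] at hz
    exact closedBall_subset_logUnits p K (show ‖z‖ ≤ (p : ℝ) ^ (-(2 : ℝ)) from hz.trans hN.le)
  have hbdd : ∃ b : ℤ, ∀ z : ℤ, closedBall (0 : K) (‖(ϖ : K)‖ ^ z) ⊆ logUnits K → b ≤ z := by
    obtain ⟨M, hM⟩ := pow_unbounded_of_one_lt R (one_lt_inv_iff₀.mpr ⟨hϖ0, hϖ1⟩)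
    refine ⟨-(M : ℤ), fun z hz => ?_⟩
    by_contra hlt
    push Not at hlt
    have hmem : ((ϖ : K) ^ z : K) ∈ closedBall (0 : K) (‖(ϖ : K)‖ ^ z) := by
      rw [mem_closedBall, dist_zero_right, norm_zpow]
    have hle : ‖((ϖ : K) ^ z : K)‖ ≤ R := by
      have := hR (hz hmem)
      rwa [mem_closedBall, dist_zero_right] at this
    rw [norm_zpow] at hle
    have hanti : ‖(ϖ : K)‖ ^ (-(M : ℤ)) ≤ ‖(ϖ : K)‖ ^ z :=
      zpow_le_zpow_right_of_le_one₀ hϖ0 hϖ1.le (by omega)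
    rw [zpow_neg, zpow_natCast, ← inv_pow] at hanti
    linarith
  obtain ⟨n₀, hn₀, hmin⟩ := Int.exists_least_of_bdd hbdd ⟨(N : ℤ), hPN⟩
  obtain ⟨z₀, hz₀, hmax⟩ := hcpt.exists_isMaxOn ⟨0, zero_mem_logUnits (p := p)⟩ continuous_norm.continuousOn
  have hmax' : ∀ z ∈ logUnits K, ‖z‖ ≤ ‖z₀‖ := fun z hz => hmax hz
  refine ⟨(ϖ : K) ^ n₀, z₀, zpow_ne_zero _ ϖ.ne_zero, ?_, ?_, ?_, hz₀, hmax'⟩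
  · intro o ho
    apply hn₀
    rw [mem_closedBall, dist_zero_right, norm_mul, norm_zpow]
    calc ‖(ϖ : K)‖ ^ n₀ * ‖o‖ ≤ ‖(ϖ : K)‖ ^ n₀ * 1 := by gcongr
      _ = ‖(ϖ : K)‖ ^ n₀ := mul_one _
  · have hfail : ¬ closedBall (0 : K) (‖(ϖ : K)‖ ^ (n₀ - 1)) ⊆ logUnits K := by
      intro h
      have := hmin _ h
      omega
    obtain ⟨w, hw, hwΛ⟩ := not_subset.mp hfail
    refine ⟨ϖ, w, hϖ, hwΛ, ?_⟩
    rw [mem_closedBall, dist_zero_right] at hw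
    rw [norm_zpow]
    calc ‖w‖ * ‖(ϖ : K)‖ ≤ ‖(ϖ : K)‖ ^ (n₀ - 1) * ‖(ϖ : K)‖ := by gcongr
      _ = ‖(ϖ : K)‖ ^ n₀ := by rw [← zpow_add_one₀ hϖ0.ne', sub_add_cancel]
  · intro h0
    have hmem : ((ϖ : K) ^ N : K) ∈ logUnits K :=
      closedBall_subset_logUnits p K (show ‖((ϖ : K) ^ N : K)‖ ≤ (p : ℝ) ^ (-(2 : ℝ)) by rw [norm_pow]; exact hN.le)
    have hle := hmax' _ hmem
    rw [h0, norm_zero, norm_pow] at hle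
    exact absurd hle (not_le.mpr (pow_pos hϖ0 N))

/-- **Every inner radius is bounded by a non-member**: if `cin·𝒪 ⊆ log_p(𝒪^×)` and `z ∉ log_p(𝒪^×)` has `‖z‖ ≤ p^{−(ρ−1)/e}`
(`e = e(K/ℚ_p)`, `ρ ∈ ℤ`), then `‖cin‖ ≤ p^{−ρ/e}` (`‖cin‖ < ‖z‖`, and the value group is `p^{(1/e)ℤ}`). [cite: NeukirchANT1999, Ch. II (5.5)] -/
theorem norm_inner_le_of_not_mem {cin z : K} (hin : ∀ o : K, ‖o‖ ≤ 1 → cin * o ∈ logUnits K) (hz : z ∉ logUnits K)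
    {ρ : ℤ} (hzle : ‖z‖ ≤ (p : ℝ) ^ (-(((ρ : ℝ) - 1) / (absRamificationIdx p K : ℝ)))) :
    ‖cin‖ ≤ (p : ℝ) ^ (-((ρ : ℝ) / (absRamificationIdx p K : ℝ))) := by
  have hp1 : (1 : ℝ) < p := by exact_mod_cast (Fact.out : p.Prime).one_lt
  have he : (0 : ℝ) < absRamificationIdx p K := by exact_mod_cast absRamificationIdx_pos p K
  by_cases hc : cin = 0
  · rw [hc, norm_zero]; positivity
  have hlt : ‖cin‖ < ‖z‖ := by
    by_contra hle
    push Not at hle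
    have hzc : ‖z / cin‖ ≤ 1 := by
      rw [norm_div, div_le_one (norm_pos_iff.mpr hc)]; exact hle
    have := hin (z / cin) hzc
    rw [mul_div_cancel₀ z hc] at this
    exact hz this
  obtain ⟨k, hk⟩ := exists_norm_eq_rpow p K hc
  rw [hk] at hlt ⊢
  have hk' : (ρ : ℝ) - 1 < k := by
    have h := lt_of_lt_of_le hlt hzle
    rw [Real.rpow_lt_rpow_left_iff hp1, neg_lt_neg_iff, div_lt_div_iff_of_pos_right he] at h
    exact h
  have hρk : (ρ : ℝ) ≤ k := by
    have : ρ - 1 < k := by exact_mod_cast hk'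
    exact_mod_cast (show ρ ≤ k by omega)
  exact Real.rpow_le_rpow_of_exponent_le hp1.le (by
    rw [neg_le_neg_iff]; exact div_le_div_of_nonneg_right hρk he.le)

end Binders

/-! ## §2. The licence at `settingPrVolSharp` for realising ideles from per-place integers at the bad places -/

variable {F : Type} [Field F] [NumberField F] (X : PilotData F) {logv : PadicLogs F} (hlog : LogvAnalytic logv)
  (M : Type) [Field M] [NumberField M]
  (archPk : ∀ (j : (thetaIndex X).Label) (vQ : (thetaIndex X).VQ), Set ((logShellsDH X logv).Packet j vQ))
  (archSub : ∀ (j : (thetaIndex X).Label) (v : (thetaIndex X).V),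
    Set ((logShellsDH X logv).Packet j ((thetaIndex X).over v)))
  (Ψ : ℤ → ∀ v : (thetaIndex X).V, v ∈ (thetaIndex X).Vbad → Set ((logShellsDH X logv).StarPacket v))
  (act : ℤ → ∀ v : (thetaIndex X).V, v ∈ (thetaIndex X).Vbad →
    (logShellsDH X logv).StarPacket v → Module.End ℚ ((logShellsDH X logv).StarPacket v))
  (Mmod : ℤ → ∀ j : (thetaIndex X).LabelStar, Set ((logShellsDH X logv).GlobalPacket j.1))
  (region : ℤ → ∀ j : (thetaIndex X).LabelStar, FinDivisor M → ∀ vQ : (thetaIndex X).VQ,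
    Set ((logShellsDH X logv).Packet j.1 vQ))
  (n : ℤ) {HT : Type} {LogLink : HT → HT → Type} {IsFull : ∀ {s t : HT}, LogLink s t → Prop}
  (lat : LGPGaussianLogThetaLattice LogLink IsFull)
  {Frd : Type} {IsoF : Frd → Frd → Type} {Ob : Frd → Type} {realify : Frd → Frd} {Strip : Type}
  {IsoS : Strip → Strip → Type} {Mv : ∀ v : (thetaIndex X).V, v ∈ (thetaIndex X).Vbad → Type}
  [∀ v h, Monoid (Mv v h)]
  (sig : GlobalLGPFrobenioidSignature (thetaIndex X).lstar (thetaIndex X).V (· ∈ (thetaIndex X).Vbad)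
    Frd IsoF Ob realify Strip IsoS Mv)
  (split : SplittingMonoids Mv) {ObΔ : Type} {N : ∀ v : (thetaIndex X).V, v ∈ (thetaIndex X).Vbad → Type}
  [∀ v h, Monoid (N v h)] (qData : QPilotData ObΔ N)
  (tq : ∀ (pp : Nat.Primes) (x : (thetaIndex X).Fibre (.inr pp)), haveI : Fact (pp : ℕ).Prime := ⟨pp.2⟩; kOf X pp.1 x)
  (t : ∀ (pp : Nat.Primes) (_ : Fin X.lstar) (x : (thetaIndex X).Fibre (.inr pp)),
    haveI : Fact (pp : ℕ).Prime := ⟨pp.2⟩; kOf X pp.1 x)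
  (htq0 : ∀ pp x, tq pp x ≠ 0)
  (htq1 : ∀ (pp : Nat.Primes) (x : (thetaIndex X).Fibre (.inr pp)),
    haveI : Fact (pp : ℕ).Prime := ⟨pp.2⟩; placeOf X pp.1 x ∉ X.S → ‖tq pp x‖ = 1)
  (col : ℤ → Column (logShellsDH X logv))
  (ht0 : ∀ pp i x, t pp i x ≠ 0)
  (ht : ∀ (pp : Nat.Primes) (i : Fin X.lstar) (x : (thetaIndex X).Fibre (.inr pp)),
    haveI : Fact (pp : ℕ).Prime := ⟨pp.2⟩
    Real.log ‖t pp i x‖ = -(X.thetaPilot i (placeOf X pp.1 x)) * logNorm F (placeOf X pp.1 x) /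
      localDegree F (placeOf X pp.1 x))
  (htq : ∀ (pp : Nat.Primes) (x : (thetaIndex X).Fibre (.inr pp)),
    haveI : Fact (pp : ℕ).Prime := ⟨pp.2⟩
    Real.log ‖tq pp x‖ = -(X.qPilot (placeOf X pp.1 x)) * logNorm F (placeOf X pp.1 x) /
      localDegree F (placeOf X pp.1 x))

include ht0 ht htq in
/-- **THE (xi-f) LICENCE AT `settingPrVolSharp` FOR REALISING IDELES, INHABITED FROM PER-PLACE INTEGERS.** Θ- and q-ideles realising the
pilot divisors of `X` (Dupuy–Hilado (3.4)). Per prime `p` integers `e_p, D_p, P_p ∈ ℕ`, `ρin_p, ρout_p ∈ ℤ` such that at every prime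
below a bad place: (i) every BAD fibre point `x | p` has `e(K_x/ℚ_p) = e_p`, `D_p/e_p ≤ d(K_x)`, `P_q(x) = P_p`, some `z ∉ log_p(𝒪^×_{K_x})`
with `‖z‖ ≤ p^{−(ρin_p−1)/e_p}` and some `z' ∈ log_p(𝒪^×_{K_x})` with `p^{−ρout_p/e_p} ≤ ‖z'‖`; (ii) the bad completions over `p` are
pairwise `ℚ_p`-isomorphic; (iii) at every label `j = i+1 ≤ l⋆`: `e_p·⌊(j²P_p − j·D_p − (j+1)·ρin_p)/e_p⌋ + (j+1)·ρout_p ≤ P_p`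
(`⌊·⌋` = `Int` division). THEN abc-iut-c312-1's `Thm311ToCor312.Licence` holds at abc-iut-c312-7's `settingPrVolSharp X …` — the
composition of abc-iut-w4-d036's exact cell over all primes, labels and tuples (good slots are units; conjugate bad slots give
`d_I − min_J d_{L_J} = (|I|−1)·d`). [cite: Mochizuki2012, IUTchIII Cor. 3.12 Step (xi-f) p. 184; Thm. 3.11 (i) (Ind1)(Ind2) p. 154;
IUTchIV Prop. 1.1 p. 9, Prop. 1.2 (i)(ii) p. 10] [cite: DupuyHilado2025, §3.3, §3.4, §3.9, §4.9, §4.12] [claim: Mochizuki2012, status: disputed] -/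
theorem licence_settingPrVolSharp_of_orders_of_realises (e D P : Nat.Primes → ℕ) (ρin ρout : Nat.Primes → ℤ)
    (hloc : ∀ (pp : Nat.Primes) (x : (thetaIndex X).Fibre (.inr pp)),
      haveI : Fact (pp : ℕ).Prime := ⟨pp.2⟩
      placeOf X pp.1 x ∈ X.S →
        absRamificationIdx (pp : ℕ) (kOf X pp.1 x) = e pp ∧
        (D pp : ℝ) / (e pp : ℝ) ≤ differentOrd (pp : ℕ) (kOf X pp.1 x) ∧
        X.qPilot (placeOf X pp.1 x) = P pp ∧
        (∃ z : kOf X pp.1 x, z ∉ logUnits (kOf X pp.1 x) ∧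
          ‖z‖ ≤ ((pp : ℕ) : ℝ) ^ (-(((ρin pp : ℝ) - 1) / (e pp : ℝ)))) ∧
        (∃ z ∈ logUnits (kOf X pp.1 x), ((pp : ℕ) : ℝ) ^ (-((ρout pp : ℝ) / (e pp : ℝ))) ≤ ‖z‖))
    (hiso : ∀ (pp : Nat.Primes) (x y : (thetaIndex X).Fibre (.inr pp)),
      haveI : Fact (pp : ℕ).Prime := ⟨pp.2⟩
      placeOf X pp.1 x ∈ X.S → placeOf X pp.1 y ∈ X.S → Nonempty (kOf X pp.1 x ≃ₐ[ℚ_[pp]] kOf X pp.1 y))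
    (hcell : ∀ (pp : Nat.Primes), (haveI : Fact (pp : ℕ).Prime := ⟨pp.2⟩
        ∃ x : (thetaIndex X).Fibre (.inr pp), placeOf X pp.1 x ∈ X.S) →
      ∀ i : Fin X.lstar,
        (e pp : ℤ) * (((((i : ℕ) + 1 : ℕ) : ℤ) ^ 2 * (P pp : ℤ) - (((i : ℕ) + 1 : ℕ) : ℤ) * (D pp : ℤ) -
            (((i : ℕ) + 2 : ℕ) : ℤ) * ρin pp) / (e pp : ℤ)) + (((i : ℕ) + 2 : ℕ) : ℤ) * ρout pp ≤ (P pp : ℤ)) :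
    Thm311ToCor312.Licence (settingPrVolSharp X hlog M archPk archSub Ψ act Mmod region n lat sig split qData tq t htq0 htq1) := by
  classical
  have hB : ∀ (pp : Nat.Primes) (x : (thetaIndex X).Fibre (.inr pp)), haveI : Fact (pp : ℕ).Prime := ⟨pp.2⟩
      ∃ cin cout : (presAt X hlog pp).k x, cin ≠ 0 ∧ (∀ o : (presAt X hlog pp).k x, ‖o‖ ≤ 1 → cin * o ∈ logUnits ((presAt X hlog pp).k x)) ∧
        (∃ (ϖ : ((presAt X hlog pp).k x)ˣ) (w : (presAt X hlog pp).k x),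
          IsUniformizer ϖ ∧ w ∉ logUnits ((presAt X hlog pp).k x) ∧ ‖w‖ * ‖(ϖ : (presAt X hlog pp).k x)‖ ≤ ‖cin‖) ∧
        cout ≠ 0 ∧ cout ∈ logUnits ((presAt X hlog pp).k x) ∧ ∀ z ∈ logUnits ((presAt X hlog pp).k x), ‖z‖ ≤ ‖cout‖ := by
    intro pp x
    haveI : Fact (pp : ℕ).Prime := ⟨pp.2⟩
    exact exists_shellRadii_binders (pp : ℕ) ((presAt X hlog pp).k x)
  choose cin cout hin0 hin hmax hout0 houtΛ hdom using hB
  refine (licence_settingPrVolSharp_iff_shellRadii_of_realises X hlog M archPk archSub Ψ act Mmod region n lat sig split qData tq t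
    htq0 htq1 ht0 ht htq cin cout hin0 hin hmax hout0 houtΛ hdom).2 fun pp i ev => ?_
  haveI : Fact (pp : ℕ).Prime := ⟨pp.2⟩
  have hp1 : (1 : ℝ) < ((pp : ℕ) : ℝ) := by exact_mod_cast pp.2.one_lt
  have hp0 : (0 : ℝ) < ((pp : ℕ) : ℝ) := by linarith
  -- `‖cin a‖ ≤ ‖cout a‖` at every slot, products nonnegative
  have hinout : ∀ x : (thetaIndex X).Fibre (.inr pp), ‖cin pp x‖ ≤ ‖cout pp x‖ := fun x =>
    hdom pp x _ (by simpa using hin pp x 1 (by simp))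
  have hprod_le : ∏ a, ‖cin pp (ev a)‖ ≤ ∏ a, ‖cout pp (ev a)‖ :=
    Finset.prod_le_prod (fun a _ => norm_nonneg _) fun a _ => hinout (ev a)
  have hprod_nn : 0 ≤ ∏ a, ‖cin pp (ev a)‖ := Finset.prod_nonneg fun a _ => norm_nonneg _
  by_cases hall : ∀ a, placeOf X pp.1 (ev a) ∈ X.S
  swap
  · -- a GOOD slot `a₀`: read the Θ-radius there (a unit), the hypothesis forces `p^m ≤ ∏‖cin‖ ≤ ∏‖cout‖`
    push Not at hall
    obtain ⟨a₀, ha₀⟩ := hall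
    refine ⟨Equiv.swap a₀ (Fin.last _), fun m hm => ?_⟩
    have hσ : (Equiv.swap a₀ (Fin.last _)) (Fin.last _) = a₀ := Equiv.swap_apply_right _ _
    obtain ⟨J₀⟩ := (inferInstance : Nonempty (DIdx (pp : ℕ) ((presAt X hlog pp).kk ev)))
    have hJ := hm J₀
    rw [hσ, ← norm_thetaIdele_eq_rpow_of_realises X tq t htq0 ht0 ht htq pp i (ev a₀),
      norm_eq_one_of_realises X t ht0 ht pp i (ev a₀) ha₀, mul_one] at hJ
    have hexp : ((pp : ℕ) : ℝ) ^ (-(dSum (pp : ℕ) ((presAt X hlog pp).kk ev) -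
        differentOrd (pp : ℕ) (DFac (pp : ℕ) ((presAt X hlog pp).kk ev) J₀))) ≤ 1 :=
      Real.rpow_le_one_of_one_le_of_nonpos hp1.le (by
        have := differentOrd_dFac_le_dSum (pp : ℕ) ((presAt X hlog pp).kk ev) J₀
        linarith)
    have hm' : ((pp : ℕ) : ℝ) ^ m ≤ ∏ a, ‖cout pp (ev a)‖ :=
      hJ.trans ((mul_le_of_le_one_left hprod_nn hexp).trans hprod_le)
    rw [← norm_qIdele_eq_rpow_of_realises X tq htq0 htq pp (ev (Fin.last _))]
    exact (mul_le_of_le_one_right (zpow_nonneg hp0.le _)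
      (norm_qIdele_le_one_of_realises X tq htq0 htq pp (ev (Fin.last _)))).trans hm'
  · -- ALL slots bad: conjugate completions, the integer cell
    refine ⟨Equiv.refl _, fun m hm => ?_⟩
    simp only [Equiv.refl_apply] at hm
    set x₀ := ev (Fin.last _) with hx₀
    obtain ⟨he, hD, hP, ⟨zin, hzin, hzinle⟩, ⟨zout, hzout, hzoutge⟩⟩ := hloc pp x₀ (hall _)
    have hepos : 0 < e pp := by rw [← he]; exact absRamificationIdx_pos (pp : ℕ) (kOf X pp.1 x₀)
    have he0 : (e pp : ℝ) ≠ 0 := by exact_mod_cast hepos.ne'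
    have hcard : Fintype.card ((thetaIndex X).Caps (Setting.labelSucc i)) = (i : ℕ) + 2 := by
      have hc : Fintype.card ((thetaIndex X).Caps (Setting.labelSucc i)) =
          Fintype.card (Fin (((Setting.labelSucc i : (thetaIndex X).Label) : ℕ) + 1)) := rfl
      rw [hc, Fintype.card_fin]
      simp [Setting.labelSucc]
    have hram : (ramIdx F (placeOf X pp.1 x₀) : ℝ) = e pp := by
      rw [ramIdx_eq F (placeOf X pp.1 x₀), ← absRamificationIdx_rescaledCompletion F (pp : ℕ) (placeOf X pp.1 x₀)
        (natCast_mem_placeOf X pp.1 x₀)]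
      exact_mod_cast he
    have hin_le : ∀ a, ‖cin pp (ev a)‖ ≤ ((pp : ℕ) : ℝ) ^ (-((ρin pp : ℝ) / (e pp : ℝ))) := by
      intro a
      obtain ⟨hea, -, -, ⟨z, hz, hzle⟩, -⟩ := hloc pp (ev a) (hall a)
      have h := norm_inner_le_of_not_mem (pp : ℕ) (kOf X pp.1 (ev a)) (hin pp (ev a)) hz (ρ := ρin pp) (by rw [hea]; exact hzle)
      rw [hea] at h
      exact h
    have hout_ge : ∀ a, ((pp : ℕ) : ℝ) ^ (-((ρout pp : ℝ) / (e pp : ℝ))) ≤ ‖cout pp (ev a)‖ := by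
      intro a
      obtain ⟨-, -, -, -, ⟨z, hz, hzge⟩⟩ := hloc pp (ev a) (hall a)
      exact hzge.trans (hdom pp (ev a) z hz)
    have hprod_in : ∏ a, ‖cin pp (ev a)‖ ≤
        (((pp : ℕ) : ℝ) ^ (-((ρin pp : ℝ) / (e pp : ℝ)))) ^ Fintype.card ((thetaIndex X).Caps (Setting.labelSucc i)) := by
      rw [← Finset.card_univ, ← Finset.prod_const]
      exact Finset.prod_le_prod (fun a _ => norm_nonneg _) fun a _ => hin_le a
    have hprod_out : (((pp : ℕ) : ℝ) ^ (-((ρout pp : ℝ) / (e pp : ℝ)))) ^ Fintype.card ((thetaIndex X).Caps (Setting.labelSucc i)) ≤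
        ∏ a, ‖cout pp (ev a)‖ := by
      rw [← Finset.card_univ, ← Finset.prod_const]
      exact Finset.prod_le_prod (fun a _ => by positivity) fun a _ => hout_ge a
    -- the least factor different of the conjugate packet
    have τ : ∀ a, kOf X pp.1 x₀ ≃ₐ[ℚ_[pp]] (presAt X hlog pp).kk ev a := fun a =>
      Classical.choice (hiso pp x₀ (ev a) (hall _) (hall a))
    have hΔ := dSum_sub_inf_differentOrd_dFac_eq_of_algEquiv' (pp : ℕ) ((presAt X hlog pp).kk ev) τ
    -- collapse the `∀ J` hypothesis to the least factor different and weaken to the integer data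
    have hm1 := (forall_dFac_le_rpow_mul_iff_inf (pp : ℕ) ((presAt X hlog pp).kk ev) hprod_nn).1 hm
    rw [hΔ, hcard, hP, hram] at hm1
    have hΔle : ((pp : ℕ) : ℝ) ^ (-(((((i : ℕ) + 2 : ℕ) : ℝ) - 1) * differentOrd (pp : ℕ) (kOf X pp.1 x₀))) ≤
        ((pp : ℕ) : ℝ) ^ (-((((((i : ℕ) + 1 : ℕ) : ℤ) * (D pp : ℤ) : ℤ) : ℝ) / (e pp : ℝ))) := by
      apply Real.rpow_le_rpow_of_exponent_le hp1.le
      have h1 : ((((i : ℕ) + 1 : ℕ) : ℝ)) * ((D pp : ℝ) / (e pp : ℝ)) ≤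
          ((((i : ℕ) + 2 : ℕ) : ℝ) - 1) * differentOrd (pp : ℕ) (kOf X pp.1 x₀) := by
        have hc : ((((i : ℕ) + 2 : ℕ) : ℝ) - 1) = (((i : ℕ) + 1 : ℕ) : ℝ) := by push_cast; ring
        rw [hc]
        exact mul_le_mul_of_nonneg_left hD (by positivity)
      have h2 : ((((((i : ℕ) + 1 : ℕ) : ℤ) * (D pp : ℤ) : ℤ) : ℝ)) / (e pp : ℝ) =
          ((((i : ℕ) + 1 : ℕ) : ℝ)) * ((D pp : ℝ) / (e pp : ℝ)) := by
        push_cast; ring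
      rw [h2]; linarith
    have hA : -(((((i : ℕ) + 1 : ℕ) : ℝ)) ^ 2 * (P pp : ℝ)) / (e pp : ℝ) =
        -((((((((i : ℕ) + 1 : ℕ) : ℤ)) ^ 2 * (P pp : ℤ) : ℤ) : ℝ)) / (e pp : ℝ)) := by
      push_cast; ring
    rw [hA] at hm1
    have hm2 : ((pp : ℕ) : ℝ) ^ m * ((pp : ℕ) : ℝ) ^ (-((((((((i : ℕ) + 1 : ℕ) : ℤ)) ^ 2 * (P pp : ℤ) : ℤ) : ℝ)) / (e pp : ℝ))) ≤
        ((pp : ℕ) : ℝ) ^ (-((((((i : ℕ) + 1 : ℕ) : ℤ) * (D pp : ℤ) : ℤ) : ℝ) / (e pp : ℝ))) *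
          (((pp : ℕ) : ℝ) ^ (-((ρin pp : ℝ) / (e pp : ℝ)))) ^ ((i : ℕ) + 2) := by
      have h := hm1.trans (mul_le_mul hΔle hprod_in hprod_nn (by positivity))
      rwa [hcard] at h
    have hm3 := (zpow_mul_rpow_le_rpow_mul_rpow_pow_iff (pp : ℕ) hepos m _ (ρin pp) _ ((i : ℕ) + 2)).1 hm2
    -- `m·e ≤ N := j²P − jD − (j+1)ρin`, so `m ≤ N / e`
    have hme : m * (e pp : ℤ) ≤ ((((i : ℕ) + 1 : ℕ) : ℤ)) ^ 2 * (P pp : ℤ) - (((i : ℕ) + 1 : ℕ) : ℤ) * (D pp : ℤ) -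
        (((i : ℕ) + 2 : ℕ) : ℤ) * ρin pp := by
      have h' : -(((((((i : ℕ) + 1 : ℕ) : ℤ) * (D pp : ℤ) : ℤ) : ℝ) / (e pp : ℝ))) * (e pp : ℝ) =
          -(((((i : ℕ) + 1 : ℕ) : ℤ) * (D pp : ℤ) : ℤ) : ℝ) := by field_simp
      rw [h'] at hm3
      have h'' : ((m * (e pp : ℤ) : ℤ) : ℝ) ≤ ((((((i : ℕ) + 1 : ℕ) : ℤ)) ^ 2 * (P pp : ℤ) - (((i : ℕ) + 1 : ℕ) : ℤ) * (D pp : ℤ) -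
          (((i : ℕ) + 2 : ℕ) : ℤ) * ρin pp : ℤ) : ℝ) := by push_cast at hm3 ⊢; linarith
      exact_mod_cast h''
    have hepos' : (0 : ℤ) < (e pp : ℤ) := by exact_mod_cast hepos
    have hmle := Int.le_ediv_of_mul_le hepos' hme
    have hcell' := hcell pp ⟨x₀, hall _⟩ i
    have hkey : (e pp : ℤ) * m + (((i : ℕ) + 2 : ℕ) : ℤ) * ρout pp ≤ (P pp : ℤ) := by
      have := mul_le_mul_of_nonneg_left hmle hepos'.le
      linarith
    -- conclude: `p^m·p^{−P/e} ≤ (p^{−ρout/e})^{i+2} ≤ ∏‖cout‖`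
    rw [hcard] at hprod_out
    have hgoal := (zpow_mul_rpow_le_rpow_mul_rpow_pow_iff (pp : ℕ) hepos m (P pp : ℤ) (ρout pp) 0 ((i : ℕ) + 2)).2
      (by
        have : (((e pp : ℤ) * m + (((i : ℕ) + 2 : ℕ) : ℤ) * ρout pp : ℤ) : ℝ) ≤ ((P pp : ℤ) : ℝ) := by exact_mod_cast hkey
        push_cast at this ⊢
        linarith)
    rw [neg_zero, Real.rpow_zero, one_mul] at hgoal
    rw [hP, hram]
    have hq : -((P pp : ℕ) : ℝ) / ((e pp : ℕ) : ℝ) = -((((P pp : ℕ) : ℤ) : ℝ) / ((e pp : ℕ) : ℝ)) := by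
      push_cast; ring
    rw [hq]
    exact hgoal.trans hprod_out

include ht0 ht htq in
/-- **BRANCH C's PER-DATUM ANTECEDENT «∃ ρ qK, QPinned ∧ PilotKummerCompatHull» INHABITED FROM PER-PLACE INTEGERS** (any columns `col`;
realising ideles, hypotheses (i)–(iii) of `licence_settingPrVolSharp_of_orders_of_realises`): the `hSHw`-shaped binder of the window
certificates of record HOLDS at such a datum (abc-iut-w5-d009's `exists_qPinned_and_hull_settingPrVolSharp_iff_licence`; realising q-ideles have
norm `≤ 1`). [cite: Mochizuki2012, IUTchIII Cor. 3.12 Step (xi-d) p. 183, (xi-f) p. 184] [cite: DupuyHilado2025, §3.3, §3.4, §3.9, §4.9]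
[claim: Mochizuki2012, status: disputed] -/
theorem exists_qPinned_and_hull_settingPrVolSharp_of_orders_of_realises (e D P : Nat.Primes → ℕ) (ρin ρout : Nat.Primes → ℤ)
    (hloc : ∀ (pp : Nat.Primes) (x : (thetaIndex X).Fibre (.inr pp)),
      haveI : Fact (pp : ℕ).Prime := ⟨pp.2⟩
      placeOf X pp.1 x ∈ X.S →
        absRamificationIdx (pp : ℕ) (kOf X pp.1 x) = e pp ∧
        (D pp : ℝ) / (e pp : ℝ) ≤ differentOrd (pp : ℕ) (kOf X pp.1 x) ∧
        X.qPilot (placeOf X pp.1 x) = P pp ∧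
        (∃ z : kOf X pp.1 x, z ∉ logUnits (kOf X pp.1 x) ∧
          ‖z‖ ≤ ((pp : ℕ) : ℝ) ^ (-(((ρin pp : ℝ) - 1) / (e pp : ℝ)))) ∧
        (∃ z ∈ logUnits (kOf X pp.1 x), ((pp : ℕ) : ℝ) ^ (-((ρout pp : ℝ) / (e pp : ℝ))) ≤ ‖z‖))
    (hiso : ∀ (pp : Nat.Primes) (x y : (thetaIndex X).Fibre (.inr pp)),
      haveI : Fact (pp : ℕ).Prime := ⟨pp.2⟩
      placeOf X pp.1 x ∈ X.S → placeOf X pp.1 y ∈ X.S → Nonempty (kOf X pp.1 x ≃ₐ[ℚ_[pp]] kOf X pp.1 y))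
    (hcell : ∀ (pp : Nat.Primes), (haveI : Fact (pp : ℕ).Prime := ⟨pp.2⟩
        ∃ x : (thetaIndex X).Fibre (.inr pp), placeOf X pp.1 x ∈ X.S) →
      ∀ i : Fin X.lstar,
        (e pp : ℤ) * (((((i : ℕ) + 1 : ℕ) : ℤ) ^ 2 * (P pp : ℤ) - (((i : ℕ) + 1 : ℕ) : ℤ) * (D pp : ℤ) -
            (((i : ℕ) + 2 : ℕ) : ℤ) * ρin pp) / (e pp : ℤ)) + (((i : ℕ) + 2 : ℕ) : ℤ) * ρout pp ≤ (P pp : ℤ)) :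
    ∃ (ρ : (∀ v : (thetaIndex X).V, v ∈ (thetaIndex X).Vbad → Set ((logShellsDH X logv).StarPacket v)) →
          ∀ (j : (thetaIndex X).Label) (vQ : (thetaIndex X).VQ), Set ((logShellsDH X logv).Packet j vQ))
        (qK : ∀ v : (thetaIndex X).V, v ∈ (thetaIndex X).Vbad → Set ((logShellsDH X logv).StarPacket v)),
        QPinned ({ toSituation := situationPrVol X hlog M archPk archSub Ψ act Mmod region, col := col } :
            LatticeSituation (thetaIndex X))
          (settingPrVolSharp X hlog M archPk archSub Ψ act Mmod region n lat sig split qData tq t htq0 htq1) ρ qK ∧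
        PilotKummerCompatHull ({ toSituation := situationPrVol X hlog M archPk archSub Ψ act Mmod region, col := col } :
            LatticeSituation (thetaIndex X))
          (settingPrVolSharp X hlog M archPk archSub Ψ act Mmod region n lat sig split qData tq t htq0 htq1) ρ qK :=
  (exists_qPinned_and_hull_settingPrVolSharp_iff_licence X hlog M archPk archSub Ψ act Mmod region n lat sig split qData tq t htq0 htq1
    col (fun pp x => norm_qIdele_le_one_of_realises X tq htq0 htq pp x)).2
    (licence_settingPrVolSharp_of_orders_of_realises X hlog M archPk archSub Ψ act Mmod region n lat sig split qData tq t htq0 htq1 ht0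
      ht htq e D P ρin ρout hloc hiso hcell)

end Summit.ABC.IUTFork.Thm311.Real

end
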